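import Summits.Ventures.PercRepro.C025ProfilePavingPLD

/-!
# THE RESIDUAL REDUCTION OF PER-LAYER DOMINANCE, ABSTRACT (night-3 g28)

`proofs/NIGHT3-G28-PAVING.md` §1 / NIGHT3-G27-PLD.md §2.  For any finite matroid `M` and any basis selector `K`
(`K X ⊆ X` independent with `ρ(X)` points), PER-LAYER DOMINANCE `(PLD)[lo, hi, δ; Θ]` follows from the single
cardinality inequality `#RS ≤ #THI` between the RESIDUAL SOURCE pairs `(I, D)` (`lo ≤ ρ(I) ≤ hi`,
`ρ(E∖I) ≥ hi+δ+1`, `D` a `δ`-subset of `K(E∖I)`) and the HIGH right-hand pairs `(J, D')` (`lo+δ ≤ ρ(E∖J) ≤ hi+δ`,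
`ρ(J) ≥ hi+1`, `D'` a `δ`-subset of `K(E∖J)`), both as `Finset.sigma` finsets (`pld_of_card_residual_le`): the low
sources are right-hand pairs (or weigh `0`) and the rest is the residual count.  The paving theorem
`PavingPLD.pld_of_paving` is the case where the natural map `(I, D) ↦ (E ∖ (I ∪ D), D)` is such an injection;
`pld_of_card_residual_le_all` is the reduction in the binder of `PLDBridge.rls_disjointSum_freeOn_of_pld`.
* `good_subset_selector` — a GOOD source (`ρ(I ∪ D) = ρ(I) + |D|`) has `D` inside EVERY independent set of `ρ(I ∪ D)`
  points of `I ∪ D` (every basis of `I ∪ D`), so its natural image never depends on the selector;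
* `natural_image_mem_high_of_good` — the natural image of a good residual source is a high pair.
No `def`, no `instance`, no notation.  Axioms: standard.
-/

open scoped Matroid

namespace PercRepro

open Finset ThmH

namespace PavingPLD

variable {α : Type} [DecidableEq α]

/-- **THE RESIDUAL REDUCTION**: `#RS ≤ #THI` (pairs, any selector `K`) gives `(PLD)[lo, hi, δ; Θ]`. -/
theorem pld_of_card_residual_le (M : Matroid α) [M.Finite] (K : Finset α → Finset α)
    (hK : ∀ X, K X ⊆ X ∧ M.Indep (K X : Set α) ∧ (K X).card = (M.eRk (X : Set α)).toNat)
    (lo hi δ Θ : ℕ) (hΘ : Θ ≤ lo + hi + δ) (hside : lo = 0 ∨ lo + hi + δ ≤ Θ)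
    (hres : (((gr M).powerset.filter (fun I : Finset α => lo ≤ (M.eRk (I : Set α)).toNat ∧
        (M.eRk (I : Set α)).toNat ≤ hi ∧ hi + δ + 1 ≤ (M.eRk ((gr M \ I : Finset α) : Set α)).toNat)).sigma
      (fun I : Finset α => powersetCard δ (K (gr M \ I)))).card ≤
      (((gr M).powerset.filter (fun J : Finset α => lo + δ ≤ (M.eRk ((gr M \ J : Finset α) : Set α)).toNat ∧
        (M.eRk ((gr M \ J : Finset α) : Set α)).toNat ≤ hi + δ ∧ hi + 1 ≤ (M.eRk (J : Set α)).toNat)).sigma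
      (fun J : Finset α => powersetCard δ (K (gr M \ J)))).card) :
    (∑ I ∈ (gr M).powerset, (if lo ≤ (M.eRk (I : Set α)).toNat ∧ (M.eRk (I : Set α)).toNat ≤ hi ∧
        Θ ≤ (M.eRk ((gr M \ I : Finset α) : Set α)).toNat + (M.eRk (I : Set α)).toNat then
        ((M.eRk ((gr M \ I : Finset α) : Set α)).toNat).choose δ else 0)) ≤
      ∑ I ∈ (gr M).powerset, (if lo + δ ≤ (M.eRk ((gr M \ I : Finset α) : Set α)).toNat ∧
        (M.eRk ((gr M \ I : Finset α) : Set α)).toNat ≤ hi + δ then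
        ((M.eRk ((gr M \ I : Finset α) : Set α)).toNat).choose δ else 0) := by
  have hL : (∑ I ∈ (gr M).powerset, (if lo ≤ (M.eRk (I : Set α)).toNat ∧ (M.eRk (I : Set α)).toNat ≤ hi ∧
          Θ ≤ (M.eRk ((gr M \ I : Finset α) : Set α)).toNat + (M.eRk (I : Set α)).toNat then
          ((M.eRk ((gr M \ I : Finset α) : Set α)).toNat).choose δ else 0)) =
      (∑ I ∈ (gr M).powerset, (if lo ≤ (M.eRk (I : Set α)).toNat ∧ (M.eRk (I : Set α)).toNat ≤ hi ∧
          Θ ≤ (M.eRk ((gr M \ I : Finset α) : Set α)).toNat + (M.eRk (I : Set α)).toNat ∧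
          (M.eRk ((gr M \ I : Finset α) : Set α)).toNat ≤ hi + δ then
          ((M.eRk ((gr M \ I : Finset α) : Set α)).toNat).choose δ else 0)) +
      (∑ I ∈ (gr M).powerset, (if lo ≤ (M.eRk (I : Set α)).toNat ∧ (M.eRk (I : Set α)).toNat ≤ hi ∧
          hi + δ + 1 ≤ (M.eRk ((gr M \ I : Finset α) : Set α)).toNat then
          ((M.eRk ((gr M \ I : Finset α) : Set α)).toNat).choose δ else 0)) := by
    rw [← sum_add_distrib]
    apply sum_congr rfl
    intro I _
    split_ifs <;> omega
  have hR : (∑ I ∈ (gr M).powerset, (if lo + δ ≤ (M.eRk ((gr M \ I : Finset α) : Set α)).toNat ∧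
          (M.eRk ((gr M \ I : Finset α) : Set α)).toNat ≤ hi + δ then
          ((M.eRk ((gr M \ I : Finset α) : Set α)).toNat).choose δ else 0)) =
      (∑ I ∈ (gr M).powerset, (if lo + δ ≤ (M.eRk ((gr M \ I : Finset α) : Set α)).toNat ∧
          (M.eRk ((gr M \ I : Finset α) : Set α)).toNat ≤ hi + δ ∧ (M.eRk (I : Set α)).toNat ≤ hi then
          ((M.eRk ((gr M \ I : Finset α) : Set α)).toNat).choose δ else 0)) +
      (∑ I ∈ (gr M).powerset, (if lo + δ ≤ (M.eRk ((gr M \ I : Finset α) : Set α)).toNat ∧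
          (M.eRk ((gr M \ I : Finset α) : Set α)).toNat ≤ hi + δ ∧ hi + 1 ≤ (M.eRk (I : Set α)).toNat then
          ((M.eRk ((gr M \ I : Finset α) : Set α)).toNat).choose δ else 0)) := by
    rw [← sum_add_distrib]
    apply sum_congr rfl
    intro I _
    split_ifs <;> omega
  rw [hL, hR]
  apply Nat.add_le_add
  · apply sum_le_sum
    intro I _
    split_ifs with h1 h2
    · exact le_rfl
    · apply Nat.le_of_eq
      apply Nat.choose_eq_zero_of_lt
      omega
    · exact Nat.zero_le _
    · exact le_rfl
  · rw [← sum_filter, ← sum_filter]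
    have e1 : ∀ s : Finset (Finset α), ∑ I ∈ s, ((M.eRk ((gr M \ I : Finset α) : Set α)).toNat).choose δ =
        (s.sigma (fun I : Finset α => powersetCard δ (K (gr M \ I)))).card := by
      intro s
      rw [card_sigma]
      apply sum_congr rfl
      intro I _
      rw [card_powersetCard, (hK _).2.2]
    rw [e1, e1]
    exact hres

/-- **THE RESIDUAL REDUCTION IN THE BRIDGE'S BINDER**: a selector `K` with `#RS ≤ #THI` at every `(lo, hi, δ)`
gives the hypothesis `hPLD` of `PLDBridge.rls_disjointSum_freeOn_of_pld`. -/
theorem pld_of_card_residual_le_all (M : Matroid α) [M.Finite] (K : Finset α → Finset α)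
    (hK : ∀ X, K X ⊆ X ∧ M.Indep (K X : Set α) ∧ (K X).card = (M.eRk (X : Set α)).toNat)
    (hres : ∀ lo hi δ : ℕ,
      (((gr M).powerset.filter (fun I : Finset α => lo ≤ (M.eRk (I : Set α)).toNat ∧
        (M.eRk (I : Set α)).toNat ≤ hi ∧ hi + δ + 1 ≤ (M.eRk ((gr M \ I : Finset α) : Set α)).toNat)).sigma
      (fun I : Finset α => powersetCard δ (K (gr M \ I)))).card ≤
      (((gr M).powerset.filter (fun J : Finset α => lo + δ ≤ (M.eRk ((gr M \ J : Finset α) : Set α)).toNat ∧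
        (M.eRk ((gr M \ J : Finset α) : Set α)).toNat ≤ hi + δ ∧ hi + 1 ≤ (M.eRk (J : Set α)).toNat)).sigma
      (fun J : Finset α => powersetCard δ (K (gr M \ J)))).card) :
    ∀ lo hi δ Θ : ℕ, Θ ≤ lo + hi + δ → (lo = 0 ∨ lo + hi + δ ≤ Θ) →
      (∑ I ∈ (gr M).powerset, (if lo ≤ (M.eRk (I : Set α)).toNat ∧ (M.eRk (I : Set α)).toNat ≤ hi ∧
          Θ ≤ (M.eRk ((gr M \ I : Finset α) : Set α)).toNat + (M.eRk (I : Set α)).toNat then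
          ((M.eRk ((gr M \ I : Finset α) : Set α)).toNat).choose δ else 0)) ≤
        ∑ I ∈ (gr M).powerset, (if lo + δ ≤ (M.eRk ((gr M \ I : Finset α) : Set α)).toNat ∧
          (M.eRk ((gr M \ I : Finset α) : Set α)).toNat ≤ hi + δ then
          ((M.eRk ((gr M \ I : Finset α) : Set α)).toNat).choose δ else 0) :=
  fun lo hi δ Θ hΘ hside => pld_of_card_residual_le M K hK lo hi δ Θ hΘ hside (hres lo hi δ)

/-- **A good source's `D` lies in every basis of `I ∪ D`**: if `ρ(I ∪ D) = ρ(I) + |D|` and `B ⊆ I ∪ D`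
is independent with `ρ(I ∪ D)` points, then `D ⊆ B` — so the natural image of a good source is a high pair for
EVERY selector. -/
theorem good_subset_selector (M : Matroid α) [M.Finite] {I D B : Finset α}
    (hgood : (M.eRk ((I ∪ D : Finset α) : Set α)).toNat = (M.eRk (I : Set α)).toNat + D.card)
    (hB : B ⊆ I ∪ D) (hBind : M.Indep (B : Set α))
    (hBcard : B.card = (M.eRk ((I ∪ D : Finset α) : Set α)).toNat) : D ⊆ B := by
  intro d hd
  by_contra hdB
  -- B ⊆ (I ∪ D) \ {d}, so ρ((I ∪ D) ∖ d) ≥ |B| = ρ(I) + |D|; but (I ∪ D) ∖ d ⊆ I ∪ (D ∖ d) has rank ≤ ρ(I) + |D| − 1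
  have hBsub : B ⊆ I ∪ (D.erase d) := by
    intro b hb
    have hb' := hB hb
    rw [mem_union] at hb' ⊢
    rcases hb' with hbI | hbD
    · exact Or.inl hbI
    · refine Or.inr (mem_erase.2 ⟨?_, hbD⟩)
      rintro rfl
      exact hdB hb
  have h1 : M.eRk (B : Set α) ≤ M.eRk ((I ∪ D.erase d : Finset α) : Set α) := M.eRk_mono (coe_subset.2 hBsub)
  have h2 : M.eRk ((I ∪ D.erase d : Finset α) : Set α) ≤ M.eRk (I : Set α) + (D.erase d).card := by
    rw [coe_union]
    refine (M.eRk_union_le_eRk_add_eRk _ _).trans (add_le_add (le_refl _) ?_)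
    rw [← Set.encard_coe_eq_coe_finsetCard]
    exact M.eRk_le_encard _
  have h3 : M.eRk (B : Set α) = B.card := by
    rw [hBind.eRk_eq_encard, Set.encard_coe_eq_coe_finsetCard]
  have hcard : (D.erase d).card + 1 = D.card := card_erase_add_one hd
  obtain ⟨x, hx⟩ : ∃ x : ℕ, M.eRk (I : Set α) = x := ⟨_, (ENat.coe_toNat (eRk_ne_top M _)).symm⟩
  obtain ⟨u, hu⟩ : ∃ u : ℕ, M.eRk ((I ∪ D.erase d : Finset α) : Set α) = u :=
    ⟨_, (ENat.coe_toNat (eRk_ne_top M _)).symm⟩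
  rw [hx, ENat.toNat_coe] at hgood
  rw [h3, hu] at h1
  rw [hu, hx] at h2
  have h1' : B.card ≤ u := by exact_mod_cast h1
  have h2' : u ≤ x + (D.erase d).card := by exact_mod_cast h2
  omega

/-- **The natural image of a good residual source is a high pair** (any finite matroid, any selector `K`):
for `I ⊆ E`, `lo ≤ ρ(I) ≤ hi`, `ρ(E∖I) ≥ hi+δ+1`, `D` a `δ`-subset of `K(E∖I)` with `ρ(I ∪ D) = ρ(I) + δ`,
the pair `(E ∖ (I ∪ D), D)` lies in the high sigma finset. -/
theorem natural_image_mem_high_of_good (M : Matroid α) [M.Finite] (K : Finset α → Finset α)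
    (hK : ∀ X, K X ⊆ X ∧ M.Indep (K X : Set α) ∧ (K X).card = (M.eRk (X : Set α)).toNat)
    {lo hi δ : ℕ} {I D : Finset α} (hI : I ⊆ gr M) (hlo : lo ≤ (M.eRk (I : Set α)).toNat)
    (hx : (M.eRk (I : Set α)).toNat ≤ hi)
    (hf : hi + δ + 1 ≤ (M.eRk ((gr M \ I : Finset α) : Set α)).toNat)
    (hD : D ∈ powersetCard δ (K (gr M \ I)))
    (hgood : (M.eRk ((I ∪ D : Finset α) : Set α)).toNat = (M.eRk (I : Set α)).toNat + δ) :
    (⟨gr M \ (I ∪ D), D⟩ : Σ _ : Finset α, Finset α) ∈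
      ((gr M).powerset.filter (fun J : Finset α => lo + δ ≤ (M.eRk ((gr M \ J : Finset α) : Set α)).toNat ∧
        (M.eRk ((gr M \ J : Finset α) : Set α)).toNat ≤ hi + δ ∧ hi + 1 ≤ (M.eRk (J : Set α)).toNat)).sigma
      (fun J : Finset α => powersetCard δ (K (gr M \ J))) := by
  rw [mem_powersetCard] at hD
  obtain ⟨hDK, hDcard⟩ := hD
  have hDE : D ⊆ gr M \ I := hDK.trans (hK _).1
  have hUE : I ∪ D ⊆ gr M := union_subset hI (hDE.trans sdiff_subset)
  have hC : hi + 1 ≤ (M.eRk ((gr M \ (I ∪ D) : Finset α) : Set α)).toNat := by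
    have h1 := toNat_eRk_le_toNat_eRk_sdiff_add_card M (gr M \ I) D
    have h2 : (gr M \ I) \ D = gr M \ (I ∪ D) := by
      ext a
      simp only [mem_sdiff, mem_union]
      tauto
    rw [h2] at h1
    omega
  rw [mem_sigma, mem_filter, mem_powerset, Finset.sdiff_sdiff_eq_self hUE, hgood, mem_powersetCard]
  refine ⟨⟨sdiff_subset, by omega, by omega, hC⟩, ?_, hDcard⟩
  rw [← hDcard] at hgood
  exact good_subset_selector M hgood (hK _).1 (hK _).2.1 (hK _).2.2

end PavingPLD

end PercRepro
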